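import Mathlib.Data.ZMod.Basic
import Mathlib.Data.Finset.Powerset
import Mathlib.Data.Finset.Card
import Mathlib.Data.Fintype.Prod
import Mathlib.Data.Fintype.Sum
import Mathlib.Data.Fintype.Powerset
import Mathlib.Data.Finset.Prod
import HarnessLib

/-!
# TABLE X (dimension 6), row 29 — kernel censuses of the two NEW residue cells of CM products:
# the `D₄` surface triple and the cyclic cell `Z(ℚ(ζ₁₅)) × S(ℚ(ζ₅))`

Cell `pub-hodgeav-hg6` (LADDER-HodgeAV row 2, director-hodge req-37 (A), Q2c «CM pilot `g ≤ 6`», co-owner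
director-hodgecm-mathlib), lead g0, 2026-08-28. HONEST FRAMING: HC, `HC_AV`, `HC_CM`, H2 are NOT proved and
nothing here is geometry: this module is a FINITE, KERNEL-DECIDED computation (two permutation models, `decide`),
the exact analogue of the tree's `Literature.AlgebraicGeometry.HodgeTheory.PohlmannSetsZeta24ProductSixfold` (the
`(4,1,1)` cell `B(ζ₂₄) × E′ × E″`, p176557) for the two other residue patterns `(2,2,2)` and `(4,2)` of TABLE X
row 29 (`TableX.status .cmProducts = .cmMixed`, `Theorems/SixfoldHodgeStatus.lean`): the non-simple CM sixfolds on
which the cell's converse cover `TableX.hcAtDim_six_of_tableX_cmSplit` still displays the (narrowed) binder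
`HCOnClass (dim 6 ∧ CM ∧ ¬ simple)`. Nothing about that binder is proved here.

DICTIONARY (not formalised here; it is Pohlmann's theorem, in the tree as
`Literature.AlgebraicGeometry.GaoUllmo2025.theorem31` = [cite: GaoUllmo2025, Thm 3.1], valid for every abelian
variety `A` of CM type with CM algebra `E = ∏ Mᵢ` and type `Φ ⊂ Hom(E, ℂ)`): `B^p(A) ⊗ ℚ̄` has the monomial basis
indexed by the `2p`-subsets `P ⊂ Hom(E, ℂ)` with `|gP ∩ Φ| = p` for every `g` in the Galois group of the
compositum of the Galois closures («Pohlmann sets»); `D^p(A) ⊗ ℚ̄` (products of divisor classes) is spanned by the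
monomials of the `2p`-sets that are DISJOINT UNIONS of `p` Pohlmann `2`-sets (a product of distinct monomials is
the monomial of the union); `B³ ⊆ B¹·B²` iff every Pohlmann `6`-set is a disjoint union of a Pohlmann `2`-set and
a Pohlmann `4`-set.

## Model A — the `D₄` surface triple `S_{Φ₁} × S_{Φ₂} × S″` (pattern `(2,2,2)`)
`G = D₄ = ⟨r, s⟩` coded as `ZMod 4 × Bool` (`(k, f) = r^k s^f`). `M` = the quartic CM field fixed by `⟨s⟩`:
`Hom(M, ℂ) = G/⟨s⟩ =` the four VERTICES `v : ZMod 4` of a square, `r^k s^f · v = k ± v`; its REFLEX field `M^r` =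
the field fixed by `⟨rs⟩`: `Hom(M^r, ℂ) = G/⟨rs⟩ =` the four EDGES `e`, `r^k s^f · e = k + (e | -e-1)`; complex
conjugation is the central element `r²` (antipode on both). Points `Fin 3 × ZMod 4`: blocks `0, 1` are two copies
of `Hom(M, ℂ)` (the factors `S_{Φ₁}`, `S_{Φ₂}`), block `2` is `Hom(M^r, ℂ)` (the factor `S″`). CM types on `M` and
on `M^r`: `{j, j+1}`, `j : ZMod 4` (one point of each antipodal pair); `S_Φ ~ S_Ψ` (isogenous) iff `Ψ ∈ {Φ, Φ̄}`
iff `Ψ = {j, j+1}` with the same or the antipodal `j` (Shimura–Taniyama; all four types are primitive, with reflex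
field `M^r`: `primitiveA_reflexA`). RESULT (`cardA₁₂`, `cardA₃_cubicA`, `classifyA`): for `Φ₂ ∉ {Φ₁, Φ̄₁}` and ANY
`Φ″` the Pohlmann counts are `(6, 19, 28)` against `(6, 15, 20)` disjoint unions — `4` exceptional classes in
`B²`, all of block multidegree `(1,1,2)` (`exceptionalA₂_eq`), `8` in `B³`, and `B³ ⊆ B¹·B²` (`cardA₃_cubicA`);
for `Φ₂ ∈ {Φ₁, Φ̄₁}` (isogenous factors) `B² = D²` (`35 = 35`). Every PAIR of factors is non-interacting
(`pairsA₂`): a 3-body cell.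

## Model B — `Z × S` (pattern `(4,2)`): `Z` the CM fourfold of a primitive type of `ℚ(ζ₁₅)`, `S` the CM surface
## of `ℚ(ζ₅)`
`Gal(ℚ(ζ₁₅)/ℚ) = (ℤ/15)ˣ ≅ C₂ × C₄` acting on `Hom(ℚ(ζ₁₅), ℂ) = (ℤ/15)ˣ` by multiplication and on `Hom(ℚ(ζ₅), ℂ) =
(ℤ/5)ˣ` through reduction mod `5`; `ℚ(ζ₁₅) = ℚ(ζ₅) · ℚ(ζ₁₅)⁺` is an `M`-ALIGNED octic with `M = ℚ(ζ₅)` CYCLIC —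
family (g) of the cell's job J10. RESULT (`cardB₁₂`, `cardB₃_cubicB`, `classifyB`): for the primitive type `Φ_Z =
{1, 2, 4, 7}` (`primitiveB`) and `Φ_S = {1, 2}` the counts are again `(6, 19, 28)` against `(6, 15, 20)`, the `4`
exceptional classes in `B²` have block multidegree `(2,2)` (`H²(Z) ⊗ H²(S)`, `exceptionalB₂_eq`), `B³ ⊆ B¹·B²`
(`cardB₃_cubicB`); over all `16 × 4` type pairs, `B² ⊋ D²` (by `4`) iff `Φ_Z` is primitive, for EITHER type of `S`
(«interacts for every type pair»).

## Provenance and ×2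
The numbers `(6,19,28) / (6,15,20)`, the supports `(1,1,2)` / `(2,2)` and «every pair decomposable» are those of
the cell's job J10 (eng-2, exact-ℚ torus census, kit j313583 / j313669: cells (e) and (g)), re-censused by a
code-disjoint engine (eng-1, GAP, kit j313740: 139/139 configurations agree) and matching the hodge-weil carver's
38 X2-violating product configurations (GAP j038496: patterns `(2,2,2)` ×4, `(2,4)` ×22, symmetric difference of
cells `∅`). This file is the kernel's third opinion on two representatives. Dossier
`run/shared/lean/pub/pub-hodgeav-hg6/TABLE-X-g6-v1.md`.

## References
* [GaoUllmo2025] Z. Gao, E. Ullmo, J. Inst. Math. Jussieu 25 (2025) 215–249 = arXiv:2411.12249, Thm 3.1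
  (Pohlmann).
* [Pohlmann1968] H. Pohlmann, Ann. of Math. (2) 88 (1968) 161–180, Thm 1.
* [MoonenZarhin1999LowDim] B. Moonen, Yu. Zarhin, Math. Ann. 315 (1999) 711–733, §5 (products, exceptional
  classes).
* [Shimura1998] G. Shimura, *Abelian Varieties with Complex Multiplication and Modular Functions* (1998),
  §8 (reflex field, primitive types).
-/

set_option linter.dupNamespace false

namespace Summit.HodgeConjecture.HodgeConjecture.TableX.CMCells

open Finset

/-! ## Model A: the `D₄` surface triple -/

/-- Points of model A: block `b : Fin 3` (two vertex blocks `0,1` = `Hom(M,ℂ)`, edge block `2` = `Hom(M^r,ℂ)`)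
and position `i : ZMod 4`. [folklore] -/
abbrev PtA : Type := Fin 3 × ZMod 4

/-- `D₄` as `ZMod 4 × Bool`, `(k, f) ↦ r^k s^f`. [folklore] -/
def d4 : Finset (ZMod 4 × Bool) := univ

/-- Multiplication of `D₄` in this coding: `r^k s^f · r^k' s^f' = r^(k ± k') s^(f+f')`. [folklore] -/
def mulD4 (g h : ZMod 4 × Bool) : ZMod 4 × Bool :=
  (g.1 + (if g.2 then -h.1 else h.1), xor g.2 h.2)

/-- The action: on vertices `r^k s^f · v = k ± v`, on edges `r^k s^f · e = k + (e | -e-1)`. [folklore] -/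
def actA (g : ZMod 4 × Bool) (x : PtA) : PtA :=
  if x.1 = 2 then (x.1, g.1 + (if g.2 then -x.2 - 1 else x.2))
  else (x.1, g.1 + (if g.2 then -x.2 else x.2))

/-- The CM type `{j, j+1}` (of `M` on a vertex block, of `M^r` on the edge block). [folklore] -/
def typ (j : ZMod 4) : Finset (ZMod 4) := {j, j + 1}

/-- The CM type `Φ₁ ⊔ Φ₂ ⊔ Φ″` of the triple with type parameters `(j₁, j₂, j₃)`. [folklore] -/
def phiA (j₁ j₂ j₃ : ZMod 4) : Finset PtA :=
  (typ j₁).image (fun i => ((0 : Fin 3), i)) ∪ (typ j₂).image (fun i => ((1 : Fin 3), i)) ∪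
    (typ j₃).image (fun i => ((2 : Fin 3), i))

/-- Pohlmann's condition for the triple `(j₁, j₂, j₃)` in degree `p`: `|gP ∩ Φ| = p` for all `g ∈ D₄`.
[cite: GaoUllmo2025, Thm 3.1] -/
def pohlA (j₁ j₂ j₃ : ZMod 4) (p : ℕ) (P : Finset PtA) : Bool :=
  decide (∀ g ∈ d4, (P.filter fun x => actA g x ∈ phiA j₁ j₂ j₃).card = p)

/-- Pohlmann `2p`-sets of the triple (they index a basis of `B^p ⊗ ℚ̄`). [cite: GaoUllmo2025, Thm 3.1] -/
def hodgeA (j₁ j₂ j₃ : ZMod 4) (p : ℕ) : Finset (Finset PtA) :=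
  ((univ : Finset PtA).powersetCard (2 * p)).filter fun P => pohlA j₁ j₂ j₃ p P

/-- `P` (a `4`-set) is a disjoint union of two Pohlmann `2`-sets (these span `D² ⊗ ℚ̄`).
[cite: GaoUllmo2025, Thm 3.1] -/
def isDivProdA₂ (j₁ j₂ j₃ : ZMod 4) (P : Finset PtA) : Bool :=
  decide (∃ Q ∈ P.powersetCard 2, pohlA j₁ j₂ j₃ 1 Q ∧ pohlA j₁ j₂ j₃ 1 (P \ Q))

/-- `P` (a `6`-set) is a disjoint union of three Pohlmann `2`-sets (these span `D³ ⊗ ℚ̄`).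
[cite: GaoUllmo2025, Thm 3.1] -/
def isDivProdA₃ (j₁ j₂ j₃ : ZMod 4) (P : Finset PtA) : Bool :=
  decide (∃ Q ∈ P.powersetCard 2, pohlA j₁ j₂ j₃ 1 Q ∧ isDivProdA₂ j₁ j₂ j₃ (P \ Q))

/-- `P` (a `6`-set) is a disjoint union of a Pohlmann `2`-set and a Pohlmann `4`-set (these span `B¹·B² ⊗ ℚ̄`).
[cite: GaoUllmo2025, Thm 3.1] -/
def isOneTwoA (j₁ j₂ j₃ : ZMod 4) (P : Finset PtA) : Bool :=
  decide (∃ Q ∈ P.powersetCard 2, pohlA j₁ j₂ j₃ 1 Q ∧ pohlA j₁ j₂ j₃ 2 (P \ Q))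

/-- `P` is supported on at most two of the three blocks. [folklore] -/
def twoBlocksA (P : Finset PtA) : Bool := decide (∃ b : Fin 3, ∀ x ∈ P, x.1 ≠ b)

/-- SANITY: `actA` is an action of the group `(d4, mulD4)` with identity `(0, false)`, and it is faithful.
[folklore] -/
theorem actA_group :
    (∀ x : PtA, actA (0, false) x = x) ∧
    (∀ g ∈ d4, ∀ h ∈ d4, ∀ x : PtA, actA (mulD4 g h) x = actA g (actA h x)) ∧
    (∀ g ∈ d4, (∀ x : PtA, actA g x = x) → g = (0, false)) := by
  refine ⟨by decide, by decide, by decide⟩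

/-- SANITY (the dictionary `G/⟨s⟩` = vertices, `G/⟨rs⟩` = edges): the stabiliser of the vertex `0` is `{1, s}`,
that of the edge `0` is `{1, rs}`, and `s`, `rs` are NOT conjugate in `D₄` (two non-isomorphic quartic fields
`M`, `M^r` inside one `D₄` closure); `r²` is central and is the antipode on every block (complex conjugation).
[cite: Shimura1998, §8] -/
theorem stabilisersA :
    (∀ g ∈ d4, actA g ((0 : Fin 3), 0) = ((0 : Fin 3), 0) ↔ g = (0, false) ∨ g = (0, true)) ∧
    (∀ g ∈ d4, actA g ((2 : Fin 3), 0) = ((2 : Fin 3), 0) ↔ g = (0, false) ∨ g = (1, true)) ∧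
    (¬ ∃ g ∈ d4, mulD4 (mulD4 g (0, true)) g = (1, true) ∧ mulD4 g g = (0, false) ∨
        mulD4 g (0, true) = mulD4 (1, true) g) ∧
    (∀ g ∈ d4, mulD4 g (2, false) = mulD4 (2, false) g) ∧
    (∀ x : PtA, actA (2, false) x = (x.1, x.2 + 2)) := by
  refine ⟨by decide, by decide, by decide, by decide, by decide⟩

/-- The right-stabiliser test for primitivity: `γ` preserves the lifted type `{g : g·0 ∈ Φ_j}` under right
multiplication. [cite: Shimura1998, §8] -/
def rightStabA (j : ZMod 4) (γ : ZMod 4 × Bool) : Bool :=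
  decide (∀ g ∈ d4, ((actA (mulD4 g γ) ((0 : Fin 3), 0)).2 ∈ typ j ↔ (actA g ((0 : Fin 3), 0)).2 ∈ typ j))

/-- SANITY: each `typ j` is a CM type (one point of each antipodal pair), the four types of `M` are PRIMITIVE
(the right stabiliser of the lifted type `{g : g·0 ∈ Φ}` is exactly `⟨s⟩`, `rightStabA`), and the left
stabiliser of `typ 0`
is `{1, rs}` — the reflex field of `(M, Φ)` is `M^r`, the field of the edge block.
[cite: Shimura1998, §8] -/
theorem primitiveA_reflexA :
    (∀ j i : ZMod 4, (i ∈ typ j ↔ i + 2 ∉ typ j)) ∧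
    (∀ j : ZMod 4, ∀ γ ∈ d4, rightStabA j γ = true → γ = (0, false) ∨ γ = (0, true)) ∧
    (∀ g ∈ d4, (typ 0).image (fun v => (actA g ((0 : Fin 3), v)).2) = typ 0 ↔ g = (0, false) ∨ g = (1, true)) := by
  refine ⟨by decide, by decide, by decide⟩

set_option maxRecDepth 8000 in
set_option maxHeartbeats 8000000 in
/-- **Census A, degrees 1 and 2**, representative triple `(Φ₁, Φ₂, Φ″) = ({0,1}, {1,2}, {0,1})` (`S_{Φ₂} ≁ S_{Φ₁}`):
`6` Pohlmann `2`-sets (the conjugate pairs: NO `Hom`-divisors between the three factors) and `19` Pohlmann `4`-sets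
against `15` disjoint unions — via [cite: GaoUllmo2025, Thm 3.1]: `dim B¹ = 6`, `dim B² = 19 = 15 + 4`,
`dim D² = 15`. [cite: MoonenZarhin1999LowDim, §5] -/
theorem cardA₁₂ : (hodgeA 0 1 0 1).card = 6 ∧ (hodgeA 0 1 0 2).card = 19 ∧
    ((hodgeA 0 1 0 2).filter fun P => isDivProdA₂ 0 1 0 P).card = 15 := by
  refine ⟨by decide +kernel, by decide +kernel, by decide +kernel⟩

set_option maxRecDepth 8000 in
set_option maxHeartbeats 8000000 in
/-- **Census A, degree 2, the exceptional sets explicitly**: the four Pohlmann `4`-sets that are not disjoint unions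
of pairs are `{(0,a), (1,a), (2,a+1), (2,a+2)}`, `a : ZMod 4` — ONE point of each vertex block and two of the edge
block: block multidegree `(1,1,2)`, i.e. classes in `H¹(S_{Φ₁}) ⊗ H¹(S_{Φ₂}) ⊗ H²(S″)`, one Galois orbit of length
`4`. [cite: GaoUllmo2025, Thm 3.1] -/
theorem exceptionalA₂_eq : (hodgeA 0 1 0 2).filter (fun P => isDivProdA₂ 0 1 0 P = false) =
    { {((0 : Fin 3), 0), ((1 : Fin 3), 0), ((2 : Fin 3), 1), ((2 : Fin 3), 2)},
      {((0 : Fin 3), 1), ((1 : Fin 3), 1), ((2 : Fin 3), 2), ((2 : Fin 3), 3)},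
      {((0 : Fin 3), 2), ((1 : Fin 3), 2), ((2 : Fin 3), 0), ((2 : Fin 3), 3)},
      {((0 : Fin 3), 3), ((1 : Fin 3), 3), ((2 : Fin 3), 0), ((2 : Fin 3), 1)} } := by
  decide +kernel

set_option maxRecDepth 8000 in
set_option maxHeartbeats 8000000 in
/-- **Census A, every PAIR of factors is non-interacting**: a Pohlmann `4`-set supported on only two of the three
blocks is a disjoint union of pairs (so `B²(S × S′) = D²` for each of the three sub-products — the interaction is
genuinely 3-body, as job J10 found: «rank 2,2,2 → 4 while every pair is 2 + 2 = 4»).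
[cite: GaoUllmo2025, Thm 3.1] -/
theorem pairsA₂ : ∀ P ∈ hodgeA 0 1 0 2, twoBlocksA P = true → isDivProdA₂ 0 1 0 P = true := by
  decide +kernel

set_option maxRecDepth 8000 in
set_option maxHeartbeats 8000000 in
/-- **Census A, degree 3**: `28` Pohlmann `6`-sets against `20` disjoint unions of three pairs (`8` exceptional
classes in `B³`), and all `28` Pohlmann `6`-sets are disjoint unions of a Pohlmann `2`-set and a Pohlmann `4`-set:
`B³ = B¹·B²` (nothing new in codimension 3). [cite: GaoUllmo2025, Thm 3.1] -/
theorem cardA₃_cubicA : (hodgeA 0 1 0 3).card = 28 ∧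
    ((hodgeA 0 1 0 3).filter fun P => isDivProdA₃ 0 1 0 P).card = 20 ∧
    ((hodgeA 0 1 0 3).filter fun P => isOneTwoA 0 1 0 P).card = 28 := by
  refine ⟨by decide +kernel, by decide +kernel, by decide +kernel⟩

/-- One row of the classification of model A: isogenous `Φ₂ ∈ {Φ₁, Φ̄₁}` ⇒ counts `(10, 35)`, else `(6, 19)`.
[folklore] -/
def classRowA (j : ZMod 4 × ZMod 4 × ZMod 4) : Bool :=
  if j.2.1 - j.1 = 0 ∨ j.2.1 - j.1 = 2 then
    (hodgeA j.1 j.2.1 j.2.2 1).card == 10 && (hodgeA j.1 j.2.1 j.2.2 2).card == 35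
  else (hodgeA j.1 j.2.1 j.2.2 1).card == 6 && (hodgeA j.1 j.2.1 j.2.2 2).card == 19

set_option maxRecDepth 8000 in
set_option maxHeartbeats 16000000 in
/-- **Census A, classification over all `4 × 4 × 4` type triples** (degrees 1, 2): if `Φ₂ ∈ {Φ₁, Φ̄₁}`
(`j₂ - j₁ ∈ {0, 2}`: isogenous factors `S_{Φ₂} ~ S_{Φ₁}`) there are `10` Pohlmann `2`-sets (`4` `Hom`-divisors) and
`35` Pohlmann `4`-sets; otherwise `6` and `19` — independently of the type `Φ″` of `S″` (all `64` triples pass the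
row test `classRowA`). [cite: GaoUllmo2025, Thm 3.1] -/
theorem classifyA :
    ((univ : Finset (ZMod 4 × ZMod 4 × ZMod 4)).filter fun j => classRowA j).card = 64 := by
  decide +kernel

/-! ## Model B: `Z(ℚ(ζ₁₅), Φ_Z) × S(ℚ(ζ₅), Φ_S)` -/

/-- Points of model B: `Hom(ℚ(ζ₁₅), ℂ) = (ℤ/15)ˣ` (left) and `Hom(ℚ(ζ₅), ℂ) = (ℤ/5)ˣ` (right). [folklore] -/
abbrev PtB : Type := ZMod 15 ⊕ ZMod 5

/-- The Galois group `(ℤ/15)ˣ`. [folklore] -/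
def units15 : Finset (ZMod 15) := univ.filter fun t => t.val.Coprime 15

/-- The twelve points. [folklore] -/
def ptsB : Finset PtB := units15.image Sum.inl ∪ ((univ : Finset (ZMod 5)).filter (· ≠ 0)).image Sum.inr

/-- The action of `g ∈ (ℤ/15)ˣ`: multiplication, through `ℤ/15 → ℤ/5` on the second block. [folklore] -/
def actB (g : ZMod 15) : PtB → PtB
  | Sum.inl t => Sum.inl (g * t)
  | Sum.inr v => Sum.inr ((g.val : ZMod 5) * v)

/-- The CM type `Φ_Z ⊔ Φ_S` with `Φ_Z ⊂ (ℤ/15)ˣ`, `Φ_S ⊂ (ℤ/5)ˣ`. [folklore] -/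
def phiB (ΦZ : Finset (ZMod 15)) (ΦS : Finset (ZMod 5)) : Finset PtB := ΦZ.image Sum.inl ∪ ΦS.image Sum.inr

/-- Pohlmann's condition for `Z × S` in degree `p`. [cite: GaoUllmo2025, Thm 3.1] -/
def pohlB (ΦZ : Finset (ZMod 15)) (ΦS : Finset (ZMod 5)) (p : ℕ) (P : Finset PtB) : Bool :=
  decide (∀ g ∈ units15, (P.filter fun x => actB g x ∈ phiB ΦZ ΦS).card = p)

/-- Pohlmann `2p`-sets of `Z × S`. [cite: GaoUllmo2025, Thm 3.1] -/
def hodgeB (ΦZ : Finset (ZMod 15)) (ΦS : Finset (ZMod 5)) (p : ℕ) : Finset (Finset PtB) :=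
  (ptsB.powersetCard (2 * p)).filter fun P => pohlB ΦZ ΦS p P

/-- Disjoint union of two Pohlmann `2`-sets. [cite: GaoUllmo2025, Thm 3.1] -/
def isDivProdB₂ (ΦZ : Finset (ZMod 15)) (ΦS : Finset (ZMod 5)) (P : Finset PtB) : Bool :=
  decide (∃ Q ∈ P.powersetCard 2, pohlB ΦZ ΦS 1 Q ∧ pohlB ΦZ ΦS 1 (P \ Q))

/-- Disjoint union of three Pohlmann `2`-sets. [cite: GaoUllmo2025, Thm 3.1] -/
def isDivProdB₃ (ΦZ : Finset (ZMod 15)) (ΦS : Finset (ZMod 5)) (P : Finset PtB) : Bool :=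
  decide (∃ Q ∈ P.powersetCard 2, pohlB ΦZ ΦS 1 Q ∧ isDivProdB₂ ΦZ ΦS (P \ Q))

/-- Disjoint union of a Pohlmann `2`-set and a Pohlmann `4`-set. [cite: GaoUllmo2025, Thm 3.1] -/
def isOneTwoB (ΦZ : Finset (ZMod 15)) (ΦS : Finset (ZMod 5)) (P : Finset PtB) : Bool :=
  decide (∃ Q ∈ P.powersetCard 2, pohlB ΦZ ΦS 1 Q ∧ pohlB ΦZ ΦS 2 (P \ Q))

/-- The representative types: `Φ_Z = {1, 2, 4, 7}`, `Φ_S = {1, 2}`. [folklore] -/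
def ΦZ₀ : Finset (ZMod 15) := {1, 2, 4, 7}

/-- See `ΦZ₀`. [folklore] -/
def ΦS₀ : Finset (ZMod 5) := {1, 2}

/-- The CM types of `ℚ(ζ₁₅)`: `4`-subsets of the units containing exactly one of `t, -t`. [folklore] -/
def cmTypes15 : Finset (Finset (ZMod 15)) :=
  (units15.powersetCard 4).filter fun Φ => ∀ t ∈ units15, (t ∈ Φ ↔ -t ∉ Φ)

/-- The CM types of `ℚ(ζ₅)`. [folklore] -/
def cmTypes5 : Finset (Finset (ZMod 5)) :=
  (((univ : Finset (ZMod 5)).filter (· ≠ 0)).powersetCard 2).filter fun Φ => ∀ t : ZMod 5, t ≠ 0 → (t ∈ Φ ↔ -t ∉ Φ)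

/-- A type of `ℚ(ζ₁₅)` is PRIMITIVE iff no unit `g ≠ 1` maps it onto itself (the field is Galois, abelian);
as a Boolean test. [cite: Shimura1998, §8] -/
def isPrimitive15 (Φ : Finset (ZMod 15)) : Bool :=
  decide (∀ g ∈ units15, Φ.image (fun t => g * t) = Φ → g = 1)

/-- SANITY: `|(ℤ/15)ˣ| = 8`, `16` CM types of `ℚ(ζ₁₅)` of which `8` are primitive (one orbit, that of `ΦZ₀`), `4` CM
types of `ℚ(ζ₅)`; `ΦZ₀` is a primitive CM type, `ΦS₀` a CM type; `g = -1` is complex conjugation on both blocks and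
reduction mod `5` is multiplicative (the restriction `Gal(ℚ(ζ₁₅)/ℚ) → Gal(ℚ(ζ₅)/ℚ)`). [folklore] -/
theorem sanityB : units15.card = 8 ∧ cmTypes15.card = 16 ∧
    (cmTypes15.filter fun Φ => isPrimitive15 Φ = true).card = 8 ∧
    ((cmTypes15.filter fun Φ => isPrimitive15 Φ = true) = units15.image fun g => ΦZ₀.image fun t => g * t) ∧
    cmTypes5.card = 4 ∧ ΦZ₀ ∈ cmTypes15 ∧ isPrimitive15 ΦZ₀ = true ∧ ΦS₀ ∈ cmTypes5 ∧
    (∀ g ∈ units15, ∀ h ∈ units15, ((g * h).val : ZMod 5) = (g.val : ZMod 5) * (h.val : ZMod 5)) ∧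
    (((-1 : ZMod 15).val : ZMod 5) = -1) := by
  refine ⟨by decide, by decide, by decide, by decide, by decide, by decide, by decide, by decide, by decide,
    by decide⟩

set_option maxRecDepth 8000 in
set_option maxHeartbeats 8000000 in
/-- **Census B, degrees 1 and 2** for `(ΦZ₀, ΦS₀)`: `6` Pohlmann `2`-sets, `19` Pohlmann `4`-sets against `15`
disjoint unions — `dim B² = 19 = 15 + 4`. [cite: GaoUllmo2025, Thm 3.1] [cite: MoonenZarhin1999LowDim, §5] -/
theorem cardB₁₂ : (hodgeB ΦZ₀ ΦS₀ 1).card = 6 ∧ (hodgeB ΦZ₀ ΦS₀ 2).card = 19 ∧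
    ((hodgeB ΦZ₀ ΦS₀ 2).filter fun P => isDivProdB₂ ΦZ₀ ΦS₀ P).card = 15 := by
  refine ⟨by decide +kernel, by decide +kernel, by decide +kernel⟩

set_option maxRecDepth 8000 in
set_option maxHeartbeats 8000000 in
/-- **Census B, the exceptional `4`-sets explicitly**: four sets with TWO points in each block — block
multidegree `(2,2)`, classes in `H²(Z) ⊗ H²(S)` (the K3-partner-line shape of TABLE X rows 23/24), one Galois
orbit of length `4`. [cite: GaoUllmo2025, Thm 3.1] -/
theorem exceptionalB₂_eq : (hodgeB ΦZ₀ ΦS₀ 2).filter (fun P => isDivProdB₂ ΦZ₀ ΦS₀ P = false) =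
    { {Sum.inl 1, Sum.inl 11, Sum.inr 2, Sum.inr 4}, {Sum.inl 2, Sum.inl 7, Sum.inr 3, Sum.inr 4},
      {Sum.inl 4, Sum.inl 14, Sum.inr 1, Sum.inr 3}, {Sum.inl 8, Sum.inl 13, Sum.inr 1, Sum.inr 2} } := by
  decide +kernel

set_option maxRecDepth 8000 in
set_option maxHeartbeats 8000000 in
/-- **Census B, degree 3**: `28` against `20`, and all `28` are unions of a `2`-set and a `4`-set: `B³ = B¹·B²`.
[cite: GaoUllmo2025, Thm 3.1] -/
theorem cardB₃_cubicB : (hodgeB ΦZ₀ ΦS₀ 3).card = 28 ∧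
    ((hodgeB ΦZ₀ ΦS₀ 3).filter fun P => isDivProdB₃ ΦZ₀ ΦS₀ P).card = 20 ∧
    ((hodgeB ΦZ₀ ΦS₀ 3).filter fun P => isOneTwoB ΦZ₀ ΦS₀ P).card = 28 := by
  refine ⟨by decide +kernel, by decide +kernel, by decide +kernel⟩

/-- One row of the classification: primitive `Φ_Z` ⇒ `19 = 15 + 4`; imprimitive ⇒ `B² = D²`. [folklore] -/
def classRowB (Φ : Finset (ZMod 15)) (Ψ : Finset (ZMod 5)) : Bool :=
  if isPrimitive15 Φ then
    (hodgeB Φ Ψ 2).card == 19 && ((hodgeB Φ Ψ 2).filter fun P => isDivProdB₂ Φ Ψ P).card == 15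
  else (hodgeB Φ Ψ 2).card == ((hodgeB Φ Ψ 2).filter fun P => isDivProdB₂ Φ Ψ P).card

set_option maxRecDepth 8000 in
set_option maxHeartbeats 16000000 in
/-- **Census B, classification over all `16 × 4 = 64` type pairs** (degree 2; all `64` pass the row test
`classRowB`): `Z × S` carries `19 = 15 + 4` Pohlmann `4`-sets iff `Φ_Z` is primitive — for EVERY type of `S`
(«interacts for every type pair», job J10 family (g), `M` cyclic); for the `8` imprimitive types (induced from a
proper CM subfield: `Z` is then isogenous to a power of a CM abelian variety of lower dimension)
`B² = D²` (`69 = 69` resp. `99 = 99`). [cite: GaoUllmo2025, Thm 3.1] -/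
theorem classifyB : ((cmTypes15 ×ˢ cmTypes5).filter fun x => classRowB x.1 x.2).card = 64 := by
  decide +kernel

end Summit.HodgeConjecture.HodgeConjecture.TableX.CMCells
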